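import Mathlib
import HarnessLib
import Literature.MathematicalPhysics.KineticTheory.VelocityFlipNoise
import Summits.AtomisticToContinuum.FouriersLaw.Theorems.JunctionLocalityConductanceLowerBoundStubKuboLinkAux4

/-!
# Weak flip stationarity tested on exponentially bounded observables

`--supports stmt-AtomisticToContinuum-11976` helper file (crux `VanishingNoiseBound`, route
`VanishingNoiseTransfer`, line `fekete-usc-one-length`, stub S3 `stub_noisyPositiveConductance`, wave 3).
The mixing-free route to the finite-volume Kubo formula of the velocity-flip chain tests the weak stationarity of
the flip steady state `μ_δ` (`∫ (L_δ + εS)φ dμ_δ = 0` for `φ ∈ C_c^∞`) against the equilibrium FORWARD FIELD of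
`L_{T,T} + εS`, which is smooth and exponentially bounded but not compactly supported. This file proves the
required extension, for the pinned chain `pinnedChain ω₂ lam β γ` (`ω₂ > 0`, `lam, β, γ ≥ 0`), `N ≥ 1`, any flip
rate `ε : ℝ`:

* `pinnedChain_integral_flipGenerator_eq_zero_of_expGrowth` — if a finite measure `μ` kills `(L_{T_L,T_R} + εS) φ`
  for every `φ ∈ C_c^∞` (`T_L, T_R ≥ 0`) and integrates `e^{ϑ'H}`, then `∫ (L + εS) f dμ = 0` for every smooth `f`
  with `|f|, |L f|, |∂_{p_0} f|, |∂_{p_{N−1}} f| ≤ C e^{ϑH}`, `ϑ < ϑ'`. Proof: the flip-free twin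
  (`pinnedChain_integral_generator_eq_zero_of_expGrowth`, crux 11749, helper IV of `ForecastSensitivity`) verbatim —
  test on `f χ(H/R)`, `R = n + 1`, `L(fχ_R) = Lf` on `{H < R}` and `|L(fχ_R)| ≤ K e^{ϑH}(1 + H)` uniformly in `R ≥ 1`,
  dominated convergence — carrying along the flip term: the energy cutoff is flip invariant (`H ∘ F_i = H`), so
  `S(fχ_R) = χ_R · Sf` with `|Sf| ≤ 2N C e^{ϑH}`, and `∫ χ_R Sf dμ → ∫ Sf dμ`.
* `helper_flipWeakEquationExpGrowth` — registered helper (notation-free restatement).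

References: Bonetto–Lebowitz–Rey-Bellet 2000 §5 (weak steady states); Bernardin–Olla 2011 §2.1; folklore.
-/

noncomputable section

open MeasureTheory Filter Topology Set
open scoped ContDiff NNReal ENNReal
open Literature.MathematicalPhysics.KineticTheory
open Literature.MathematicalPhysics.KineticTheory.HeatConduction
open Summit.AtomisticToContinuum.FouriersLaw.Theorems.SubdiffusiveBondHeat
open Summit.AtomisticToContinuum.FouriersLaw.Theorems.LinearResponseFTUR
open Summit.AtomisticToContinuum.FouriersLaw.Cruxes.SuperadditiveResistance.FloatingProbeBypassLaplacian
open Summit.AtomisticToContinuum.FouriersLaw.Cruxes.ConductanceLowerBound.ForecastSensitivity (one_add_mul_exp_le)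

namespace Summit.AtomisticToContinuum.FouriersLaw.Theorems.VanishingNoiseBound

variable {N : ℕ}

/-! ## Weak flip stationarity tested on exponentially bounded observables -/

/-- **Weak flip stationarity for exponentially bounded observables.** For the pinned chain (`ω₂ > 0`,
`lam, β, γ ≥ 0`, `N ≥ 1`, `T_L, T_R ≥ 0`, any `ε`) and a finite measure `μ` with `∫ (L + εS) φ dμ = 0` for all
`φ ∈ C_c^∞` and `e^{ϑ'H} ∈ L¹(μ)`: every smooth `f` with `|f|`, `|L f|`, `|∂_{p_0} f|`, `|∂_{p_{N−1}} f| ≤ C e^{ϑH}`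
(`ϑ < ϑ'`) has `∫ (L + εS) f dμ = 0`. -/
theorem pinnedChain_integral_flipGenerator_eq_zero_of_expGrowth {ω₂ lam β γ : ℝ} (hω : 0 < ω₂) (hl : 0 ≤ lam)
    (hβ : 0 ≤ β) (hγ : 0 ≤ γ) (hN : 0 < N) {T_L T_R : ℝ} (hTL : 0 ≤ T_L) (hTR : 0 ≤ T_R) (ε : ℝ)
    (μ : Measure (PhaseSpace N)) [IsFiniteMeasure μ]
    (hweak : ∀ g : PhaseSpace N → ℝ, ContDiff ℝ ((⊤ : ℕ∞) : WithTop ℕ∞) g → HasCompactSupport g →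
      ∫ x, (pinnedChain ω₂ lam β γ).flipGenerator N T_L T_R ε g x ∂μ = 0)
    {ϑ ϑ' : ℝ} (hϑϑ' : ϑ < ϑ')
    (hexp : Integrable (fun x => Real.exp (ϑ' * (pinnedChain ω₂ lam β γ).hamiltonian N x)) μ)
    {f : PhaseSpace N → ℝ} {C : ℝ} (hf : ContDiff ℝ ((⊤ : ℕ∞) : WithTop ℕ∞) f)
    (hfb : ∀ x, |f x| ≤ C * Real.exp (ϑ * (pinnedChain ω₂ lam β γ).hamiltonian N x))
    (hLb : ∀ x, |(pinnedChain ω₂ lam β γ).generator N T_L T_R f x| ≤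
      C * Real.exp (ϑ * (pinnedChain ω₂ lam β γ).hamiltonian N x))
    (hP0 : ∀ x, |partialP ⟨0, hN⟩ f x| ≤ C * Real.exp (ϑ * (pinnedChain ω₂ lam β γ).hamiltonian N x))
    (hP1 : ∀ x, |partialP ⟨N - 1, Nat.sub_lt hN one_pos⟩ f x| ≤
      C * Real.exp (ϑ * (pinnedChain ω₂ lam β γ).hamiltonian N x)) :
    ∫ x, (pinnedChain ω₂ lam β γ).flipGenerator N T_L T_R ε f x ∂μ = 0 := by
  -- adapted from `pinnedChain_integral_generator_eq_zero_of_expGrowth` (…ConductanceLowerBoundStubKuboLinkAux4,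
  -- crux 11749), itself adapted from `pinnedChain_integral_generator_eq_zero_of_growth`; the flip term
  -- `εS(fχ_R) = ε χ_R Sf` (the cutoff is flip invariant) is carried along by dominated convergence.
  have hN1 : N - 1 < N := Nat.sub_lt hN one_pos
  have hU : ContDiff ℝ ∞ (pinnedChain ω₂ lam β γ).U := pinnedChain_contDiff_U ω₂ lam β γ
  have hV : ContDiff ℝ ∞ (pinnedChain ω₂ lam β γ).V := pinnedChain_contDiff_V ω₂ lam β γ
  have hU1 : ContDiff ℝ 1 (pinnedChain ω₂ lam β γ).U := pinnedChain_contDiff_U ω₂ lam β γ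
  have hV1 : ContDiff ℝ 1 (pinnedChain ω₂ lam β γ).V := pinnedChain_contDiff_V ω₂ lam β γ
  have hHs : ContDiff ℝ ∞ ((pinnedChain ω₂ lam β γ).hamiltonian N) :=
    (pinnedChain ω₂ lam β γ).contDiff_hamiltonian hU hV N
  have hH2 : ContDiff ℝ 2 ((pinnedChain ω₂ lam β γ).hamiltonian N) := hHs.of_le (by norm_cast)
  have hHd : Differentiable ℝ ((pinnedChain ω₂ lam β γ).hamiltonian N) :=
    hH2.differentiable (by norm_num)
  have hf2 : ContDiff ℝ 2 f := hf.of_le (by norm_cast)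
  have hfd : Differentiable ℝ f := hf2.differentiable (by norm_num)
  have hconf := pinnedChain_isConfining hω hl hβ hγ
  have hH0 : ∀ x, 0 ≤ (pinnedChain ω₂ lam β γ).hamiltonian N x := fun x =>
    pinnedChain_hamiltonian_nonneg hω.le hl hβ γ N x
  have hPγ : (pinnedChain ω₂ lam β γ).γ = γ := rfl
  have hγL : 0 ≤ (pinnedChain ω₂ lam β γ).γ * T_L := by rw [hPγ]; positivity
  have hγR : 0 ≤ (pinnedChain ω₂ lam β γ).γ * T_R := by rw [hPγ]; positivity
  obtain ⟨M₁, hM₁0, hM₁⟩ := exists_bound_deriv_smoothCutoff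
  obtain ⟨M₂, hM₂0, hM₂⟩ := exists_bound_deriv_deriv_smoothCutoff
  -- the weight `a = e^{ϑH} > 0`
  set E : PhaseSpace N → ℝ := fun x => Real.exp (ϑ * (pinnedChain ω₂ lam β γ).hamiltonian N x) with hE
  have hE0 : ∀ x, 0 < E x := fun x => Real.exp_pos _
  have hC0 : 0 ≤ C := by
    have h1 := hfb 0
    rcases lt_or_ge C 0 with h | h
    · have := mul_neg_of_neg_of_pos h (hE0 0)
      linarith [abs_nonneg (f 0)]
    · exact h
  -- elementary energy bounds on the momenta
  have hp2 : ∀ (x : PhaseSpace N) (i : Fin N), x.2 i ^ 2 ≤ 2 * (pinnedChain ω₂ lam β γ).hamiltonian N x := by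
    intro x i
    have h1 := (pinnedChain ω₂ lam β γ).site_le_hamiltonian hconf.U_nonneg hconf.V_nonneg N x i
    have h2 := hconf.U_nonneg (x.1 i)
    linarith
  have hp1 : ∀ (x : PhaseSpace N) (i : Fin N), |x.2 i| ≤ 1 + (pinnedChain ω₂ lam β γ).hamiltonian N x := by
    intro x i
    have h1 := abs_le_half_add_sq_half (x.2 i)
    have h2 := hp2 x i
    linarith
  -- the key pointwise formula for `L(f χ(H/R))`
  have key : ∀ (R : ℝ) (x : PhaseSpace N),
      (pinnedChain ω₂ lam β γ).generator N T_L T_R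
          (fun y => f y * smoothCutoff ((pinnedChain ω₂ lam β γ).hamiltonian N y / R)) x =
        smoothCutoff ((pinnedChain ω₂ lam β γ).hamiltonian N x / R) *
            (pinnedChain ω₂ lam β γ).generator N T_L T_R f x +
          f x * ((pinnedChain ω₂ lam β γ).γ *
            ((T_L * (deriv (deriv smoothCutoff) ((pinnedChain ω₂ lam β γ).hamiltonian N x / R) / R ^ 2 *
                  x.2 ⟨0, hN⟩ ^ 2 +
                deriv smoothCutoff ((pinnedChain ω₂ lam β γ).hamiltonian N x / R) / R) -
              deriv smoothCutoff ((pinnedChain ω₂ lam β γ).hamiltonian N x / R) / R * x.2 ⟨0, hN⟩ ^ 2) +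
            (T_R * (deriv (deriv smoothCutoff) ((pinnedChain ω₂ lam β γ).hamiltonian N x / R) / R ^ 2 *
                  x.2 ⟨N - 1, hN1⟩ ^ 2 +
                deriv smoothCutoff ((pinnedChain ω₂ lam β γ).hamiltonian N x / R) / R) -
              deriv smoothCutoff ((pinnedChain ω₂ lam β γ).hamiltonian N x / R) / R *
                x.2 ⟨N - 1, hN1⟩ ^ 2))) +
          deriv smoothCutoff ((pinnedChain ω₂ lam β γ).hamiltonian N x / R) / R *
            (Real.sqrt (2 * (pinnedChain ω₂ lam β γ).γ * T_L) ^ 2 * (x.2 ⟨0, hN⟩ * partialP ⟨0, hN⟩ f x) +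
              Real.sqrt (2 * (pinnedChain ω₂ lam β γ).γ * T_R) ^ 2 *
                (x.2 ⟨N - 1, hN1⟩ * partialP ⟨N - 1, hN1⟩ f x)) := by
    intro R x
    rw [generator_mul_cutoff _ hN hγL hγR hH2 hf2 R x,
      generator_comp_hamiltonian_closed _ hN hHd (hasDerivAt_scaled_smoothCutoff R)
        (hasDerivAt_deriv_scaled_smoothCutoff R) T_L T_R x,
      carreDuChamp_hamiltonian _ hN hHd hfd T_L T_R x]
  -- far from the cut-off the truncation is invisible
  have key_far : ∀ (R : ℝ) (x : PhaseSpace N), 0 < R → (pinnedChain ω₂ lam β γ).hamiltonian N x < R →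
      (pinnedChain ω₂ lam β γ).generator N T_L T_R
          (fun y => f y * smoothCutoff ((pinnedChain ω₂ lam β γ).hamiltonian N y / R)) x =
        (pinnedChain ω₂ lam β γ).generator N T_L T_R f x := by
    intro R x hR hx
    obtain ⟨h1, h2, h3⟩ := smoothCutoff_div_of_lt hR hx
    rw [key R x, h1, h2, h3]
    ring
  -- the uniform bound for `R ≥ 1`
  set K₁ : ℝ := γ * ((T_L + T_R) * (2 * M₂ + M₁) + 4 * M₁) with hK₁
  set G : ℝ := Real.sqrt (2 * (pinnedChain ω₂ lam β γ).γ * T_L) ^ 2 +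
    Real.sqrt (2 * (pinnedChain ω₂ lam β γ).γ * T_R) ^ 2 with hG
  set K : ℝ := C + C * K₁ + M₁ * G * C with hK
  have key_bd : ∀ (R : ℝ) (x : PhaseSpace N), 1 ≤ R →
      |(pinnedChain ω₂ lam β γ).generator N T_L T_R
          (fun y => f y * smoothCutoff ((pinnedChain ω₂ lam β γ).hamiltonian N y / R)) x| ≤
        K * (E x * (1 + (pinnedChain ω₂ lam β γ).hamiltonian N x)) := by
    intro R x hR
    rw [key R x]
    have hR0 : 0 < R := by linarith
    have hh := hH0 x
    have hF' : |deriv smoothCutoff ((pinnedChain ω₂ lam β γ).hamiltonian N x / R) / R| ≤ M₁ := by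
      rw [abs_div, abs_of_pos hR0]
      exact (div_le_self (abs_nonneg _) hR).trans (hM₁ _)
    have hF'' : |deriv (deriv smoothCutoff) ((pinnedChain ω₂ lam β γ).hamiltonian N x / R) / R ^ 2| ≤ M₂ := by
      rw [abs_div, abs_of_pos (by positivity : (0:ℝ) < R ^ 2)]
      exact (div_le_self (abs_nonneg _) (by nlinarith)).trans (hM₂ _)
    have hbath : ∀ (T : ℝ), 0 ≤ T → ∀ (p : ℝ), p ^ 2 ≤ 2 * (pinnedChain ω₂ lam β γ).hamiltonian N x →
        |T * (deriv (deriv smoothCutoff) ((pinnedChain ω₂ lam β γ).hamiltonian N x / R) / R ^ 2 * p ^ 2 +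
            deriv smoothCutoff ((pinnedChain ω₂ lam β γ).hamiltonian N x / R) / R) -
          deriv smoothCutoff ((pinnedChain ω₂ lam β γ).hamiltonian N x / R) / R * p ^ 2| ≤
          T * (M₂ * (2 * (pinnedChain ω₂ lam β γ).hamiltonian N x) + M₁) +
            M₁ * (2 * (pinnedChain ω₂ lam β γ).hamiltonian N x) := by
      intro T hT p hp
      set a := deriv (deriv smoothCutoff) ((pinnedChain ω₂ lam β γ).hamiltonian N x / R) / R ^ 2 with ha
      set b := deriv smoothCutoff ((pinnedChain ω₂ lam β γ).hamiltonian N x / R) / R with hb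
      have hp0 : 0 ≤ p ^ 2 := sq_nonneg p
      calc |T * (a * p ^ 2 + b) - b * p ^ 2| ≤ |T * (a * p ^ 2 + b)| + |b * p ^ 2| := abs_sub _ _
        _ = T * |a * p ^ 2 + b| + |b| * p ^ 2 := by
            rw [abs_mul, abs_mul, abs_of_nonneg hT, abs_of_nonneg hp0]
        _ ≤ T * (|a| * p ^ 2 + |b|) + |b| * p ^ 2 := by
            gcongr
            calc |a * p ^ 2 + b| ≤ |a * p ^ 2| + |b| := abs_add_le _ _
              _ = |a| * p ^ 2 + |b| := by rw [abs_mul, abs_of_nonneg hp0]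
        _ ≤ T * (M₂ * (2 * (pinnedChain ω₂ lam β γ).hamiltonian N x) + M₁) +
              M₁ * (2 * (pinnedChain ω₂ lam β γ).hamiltonian N x) := by
            gcongr
    have hmid : |(pinnedChain ω₂ lam β γ).γ *
        ((T_L * (deriv (deriv smoothCutoff) ((pinnedChain ω₂ lam β γ).hamiltonian N x / R) / R ^ 2 *
              x.2 ⟨0, hN⟩ ^ 2 +
            deriv smoothCutoff ((pinnedChain ω₂ lam β γ).hamiltonian N x / R) / R) -
          deriv smoothCutoff ((pinnedChain ω₂ lam β γ).hamiltonian N x / R) / R * x.2 ⟨0, hN⟩ ^ 2) +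
        (T_R * (deriv (deriv smoothCutoff) ((pinnedChain ω₂ lam β γ).hamiltonian N x / R) / R ^ 2 *
              x.2 ⟨N - 1, hN1⟩ ^ 2 +
            deriv smoothCutoff ((pinnedChain ω₂ lam β γ).hamiltonian N x / R) / R) -
          deriv smoothCutoff ((pinnedChain ω₂ lam β γ).hamiltonian N x / R) / R * x.2 ⟨N - 1, hN1⟩ ^ 2))| ≤
        K₁ * (1 + (pinnedChain ω₂ lam β γ).hamiltonian N x) := by
      have hA := hbath T_L hTL (x.2 ⟨0, hN⟩) (hp2 x _)
      have hB := hbath T_R hTR (x.2 ⟨N - 1, hN1⟩) (hp2 x _)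
      rw [abs_mul, hPγ, abs_of_nonneg hγ, hK₁]
      have hsum := (abs_add_le _ _).trans (add_le_add hA hB)
      have hT : 0 ≤ T_L + T_R := add_nonneg hTL hTR
      calc γ * _ ≤ γ * (T_L * (M₂ * (2 * (pinnedChain ω₂ lam β γ).hamiltonian N x) + M₁) +
            M₁ * (2 * (pinnedChain ω₂ lam β γ).hamiltonian N x) +
            (T_R * (M₂ * (2 * (pinnedChain ω₂ lam β γ).hamiltonian N x) + M₁) +
              M₁ * (2 * (pinnedChain ω₂ lam β γ).hamiltonian N x))) :=
            mul_le_mul_of_nonneg_left hsum hγ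
        _ ≤ γ * ((T_L + T_R) * (2 * M₂ + M₁) + 4 * M₁) * (1 + (pinnedChain ω₂ lam β γ).hamiltonian N x) := by
            have e1 : γ * (T_L * (M₂ * (2 * (pinnedChain ω₂ lam β γ).hamiltonian N x) + M₁) +
                M₁ * (2 * (pinnedChain ω₂ lam β γ).hamiltonian N x) +
                (T_R * (M₂ * (2 * (pinnedChain ω₂ lam β γ).hamiltonian N x) + M₁) +
                  M₁ * (2 * (pinnedChain ω₂ lam β γ).hamiltonian N x))) =
                γ * ((T_L + T_R) * (2 * M₂ * (pinnedChain ω₂ lam β γ).hamiltonian N x + M₁) +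
                  4 * M₁ * (pinnedChain ω₂ lam β γ).hamiltonian N x) := by ring
            rw [e1]
            have hXY : (T_L + T_R) * (2 * M₂ * (pinnedChain ω₂ lam β γ).hamiltonian N x + M₁) +
                4 * M₁ * (pinnedChain ω₂ lam β γ).hamiltonian N x ≤
                ((T_L + T_R) * (2 * M₂ + M₁) + 4 * M₁) * (1 + (pinnedChain ω₂ lam β γ).hamiltonian N x) := by
              nlinarith [mul_nonneg hT hM₂0, mul_nonneg (mul_nonneg hT hM₁0) hh, hM₁0, hh]
            calc γ * ((T_L + T_R) * (2 * M₂ * (pinnedChain ω₂ lam β γ).hamiltonian N x + M₁) +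
                  4 * M₁ * (pinnedChain ω₂ lam β γ).hamiltonian N x)
                ≤ γ * (((T_L + T_R) * (2 * M₂ + M₁) + 4 * M₁) *
                    (1 + (pinnedChain ω₂ lam β γ).hamiltonian N x)) := mul_le_mul_of_nonneg_left hXY hγ
              _ = _ := by ring
    have hΓ : |Real.sqrt (2 * (pinnedChain ω₂ lam β γ).γ * T_L) ^ 2 * (x.2 ⟨0, hN⟩ * partialP ⟨0, hN⟩ f x) +
          Real.sqrt (2 * (pinnedChain ω₂ lam β γ).γ * T_R) ^ 2 *
            (x.2 ⟨N - 1, hN1⟩ * partialP ⟨N - 1, hN1⟩ f x)| ≤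
        G * (C * E x) * (1 + (pinnedChain ω₂ lam β γ).hamiltonian N x) := by
      have hone : ∀ (c : ℝ) (i : Fin N), |partialP i f x| ≤ C * E x →
          |c ^ 2 * (x.2 i * partialP i f x)| ≤
            c ^ 2 * (C * E x) * (1 + (pinnedChain ω₂ lam β γ).hamiltonian N x) := by
        intro c i h2
        rw [abs_mul, abs_mul, abs_of_nonneg (sq_nonneg c)]
        have h1 := hp1 x i
        calc c ^ 2 * (|x.2 i| * |partialP i f x|) ≤ c ^ 2 * ((1 + (pinnedChain ω₂ lam β γ).hamiltonian N x) *
              (C * E x)) := by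
              refine mul_le_mul_of_nonneg_left ?_ (sq_nonneg c)
              exact mul_le_mul h1 h2 (abs_nonneg _) (by linarith)
          _ = _ := by ring
      refine (abs_add_le _ _).trans ((add_le_add (hone _ _ (hP0 x)) (hone _ _ (hP1 x))).trans_eq ?_)
      rw [hG]; ring
    have := abs_three_terms_le (abs_smoothCutoff_le_one ((pinnedChain ω₂ lam β γ).hamiltonian N x / R))
      (hLb x) (hfb x) hmid hF' hΓ hC0 (hE0 x).le hh
    rw [hK]
    exact this
  -- dominated convergence along `R = n + 1`
  have hcont : ∀ n : ℕ, Continuous ((pinnedChain ω₂ lam β γ).generator N T_L T_R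
      (fun y => f y * smoothCutoff ((pinnedChain ω₂ lam β γ).hamiltonian N y / ((n : ℝ) + 1)))) := by
    intro n
    refine (pinnedChain ω₂ lam β γ).continuous_generator hU1 hV1 N T_L T_R (hf2.mul ?_)
    exact (contDiff_smoothCutoff (n := 2)).comp (hH2.div_const _)
  have hsmooth : ∀ n : ℕ, ContDiff ℝ ∞
      (fun y => f y * smoothCutoff ((pinnedChain ω₂ lam β γ).hamiltonian N y / ((n : ℝ) + 1))) := fun n =>
    hf.mul ((contDiff_smoothCutoff (n := ⊤)).comp (hHs.div_const _))
  have hsupp : ∀ n : ℕ, HasCompactSupport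
      (fun y => f y * smoothCutoff ((pinnedChain ω₂ lam β γ).hamiltonian N y / ((n : ℝ) + 1))) := by
    intro n
    refine HasCompactSupport.intro
      (pinnedChain_isCompact_setOf_hamiltonian_le hω hl hβ γ N (2 * ((n : ℝ) + 1))) fun x hx => ?_
    have hx' : 2 ≤ (pinnedChain ω₂ lam β γ).hamiltonian N x / ((n : ℝ) + 1) := by
      rw [le_div_iff₀ (by positivity)]
      simp only [mem_setOf_eq, not_le] at hx
      linarith
    simp [smoothCutoff_of_two_le hx']
  -- the majorant `K e^{ϑH}(1 + H) ≤ K (e^ε/ε) e^{ϑ'H}`, `ε = ϑ' − ϑ`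
  have hε₀ : 0 < ϑ' - ϑ := by linarith
  have hmaj' : ∀ x, K * (E x * (1 + (pinnedChain ω₂ lam β γ).hamiltonian N x)) ≤
      K * (Real.exp (ϑ' - ϑ) / (ϑ' - ϑ)) * Real.exp (ϑ' * (pinnedChain ω₂ lam β γ).hamiltonian N x) := by
    intro x
    have hK₁0 : 0 ≤ K₁ := by rw [hK₁]; positivity
    have hG0 : 0 ≤ G := by rw [hG]; positivity
    have hK0 : 0 ≤ K := by rw [hK]; positivity
    have h1 := one_add_mul_exp_le hε₀ ϑ (hH0 x)
    rw [show ϑ + (ϑ' - ϑ) = ϑ' by ring] at h1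
    calc K * (E x * (1 + (pinnedChain ω₂ lam β γ).hamiltonian N x))
        = K * ((1 + (pinnedChain ω₂ lam β γ).hamiltonian N x) * E x) := by ring
      _ ≤ K * ((Real.exp (ϑ' - ϑ) / (ϑ' - ϑ)) *
          Real.exp (ϑ' * (pinnedChain ω₂ lam β γ).hamiltonian N x)) := mul_le_mul_of_nonneg_left h1 hK0
      _ = _ := by ring
  have hbound_int' : Integrable (fun x => K * (Real.exp (ϑ' - ϑ) / (ϑ' - ϑ)) *
      Real.exp (ϑ' * (pinnedChain ω₂ lam β γ).hamiltonian N x)) μ := hexp.const_mul _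
  -- the flip term: `S(fχ_R) = χ_R · Sf`, `|Sf| ≤ 2N C e^{ϑH}`
  have hHflip : ∀ (i : Fin N) (x : PhaseSpace N),
      (pinnedChain ω₂ lam β γ).hamiltonian N (momentumFlip i x) = (pinnedChain ω₂ lam β γ).hamiltonian N x :=
    fun i x => (pinnedChain ω₂ lam β γ).hamiltonian_momentumFlip i x
  have hSmul : ∀ (n : ℕ) (x : PhaseSpace N),
      flipNoise N (fun y => f y * smoothCutoff ((pinnedChain ω₂ lam β γ).hamiltonian N y / ((n : ℝ) + 1))) x =
        smoothCutoff ((pinnedChain ω₂ lam β γ).hamiltonian N x / ((n : ℝ) + 1)) * flipNoise N f x := by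
    intro n x
    rw [flipNoise_eq, flipNoise_eq, Finset.mul_sum]
    refine Finset.sum_congr rfl fun i _ => ?_
    rw [hHflip i x]; ring
  have hSf_cont : Continuous (flipNoise N f) := by
    have h : flipNoise N f = fun x => ∑ i, (f (momentumFlip i x) - f x) := funext fun x => flipNoise_eq N f x
    rw [h]
    exact continuous_finsetSum _ fun i _ => (hf.continuous.comp (continuous_momentumFlip i)).sub hf.continuous
  have hSf_bd : ∀ x, |flipNoise N f x| ≤ 2 * N * C * E x := by
    intro x
    rw [flipNoise_eq]
    calc |∑ i : Fin N, (f (momentumFlip i x) - f x)| ≤ ∑ i : Fin N, |f (momentumFlip i x) - f x| :=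
          Finset.abs_sum_le_sum_abs _ _
      _ ≤ ∑ _i : Fin N, 2 * C * E x := by
          refine Finset.sum_le_sum fun i _ => ?_
          have h1 := hfb (momentumFlip i x)
          rw [hHflip i x] at h1
          have h2 := hfb x
          calc |f (momentumFlip i x) - f x| ≤ |f (momentumFlip i x)| + |f x| := abs_sub _ _
            _ ≤ C * E x + C * E x := add_le_add h1 h2
            _ = 2 * C * E x := by ring
      _ = 2 * N * C * E x := by simp [Finset.sum_const, Finset.card_univ, Fintype.card_fin]; ring
  have hε' : 0 < ϑ' - ϑ := by linarith
  have hEE' : ∀ x, E x ≤ Real.exp (ϑ' * (pinnedChain ω₂ lam β γ).hamiltonian N x) := fun x =>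
    Real.exp_le_exp.2 (mul_le_mul_of_nonneg_right hϑϑ'.le (hH0 x))
  have hSf_int : Integrable (flipNoise N f) μ := by
    refine (hexp.const_mul (2 * N * C)).mono' hSf_cont.aestronglyMeasurable (Eventually.of_forall fun x => ?_)
    rw [Real.norm_eq_abs]
    exact (hSf_bd x).trans (mul_le_mul_of_nonneg_left (hEE' x) (by positivity))
  have hχSf_int : ∀ n : ℕ, Integrable (fun x =>
      smoothCutoff ((pinnedChain ω₂ lam β γ).hamiltonian N x / ((n : ℝ) + 1)) * flipNoise N f x) μ := by
    intro n
    refine hSf_int.norm.mono' (((contDiff_smoothCutoff (n := 0)).continuous.comp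
      (hHs.continuous.div_const _)).mul hSf_cont).aestronglyMeasurable (Eventually.of_forall fun x => ?_)
    rw [Real.norm_eq_abs, Real.norm_eq_abs, abs_mul]
    exact mul_le_of_le_one_left (abs_nonneg _) (abs_smoothCutoff_le_one _)
  have hgen_int : ∀ n : ℕ, Integrable ((pinnedChain ω₂ lam β γ).generator N T_L T_R
      (fun y => f y * smoothCutoff ((pinnedChain ω₂ lam β γ).hamiltonian N y / ((n : ℝ) + 1)))) μ := by
    intro n
    refine (hbound_int'.mono' (hcont n).aestronglyMeasurable (Eventually.of_forall fun x => ?_))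
    rw [Real.norm_eq_abs]
    exact (key_bd _ x (by simp)).trans (hmaj' x)
  have hzero : ∀ n : ℕ, ∫ x, (pinnedChain ω₂ lam β γ).generator N T_L T_R
      (fun y => f y * smoothCutoff ((pinnedChain ω₂ lam β γ).hamiltonian N y / ((n : ℝ) + 1))) x ∂μ =
      -ε * ∫ x, smoothCutoff ((pinnedChain ω₂ lam β γ).hamiltonian N x / ((n : ℝ) + 1)) * flipNoise N f x ∂μ := by
    intro n
    have h := hweak _ (hsmooth n) (hsupp n)
    simp only [OscillatorChain.flipGenerator_eq_add_flipNoise, hSmul n] at h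
    rw [integral_add (hgen_int n) ((hχSf_int n).const_mul ε), integral_const_mul] at h
    linarith
  have hlimS : Tendsto (fun n : ℕ => ∫ x, smoothCutoff ((pinnedChain ω₂ lam β γ).hamiltonian N x / ((n : ℝ) + 1)) *
      flipNoise N f x ∂μ) atTop (𝓝 (∫ x, flipNoise N f x ∂μ)) := by
    refine tendsto_integral_of_dominated_convergence (fun x => ‖flipNoise N f x‖)
      (fun n => (hχSf_int n).aestronglyMeasurable) hSf_int.norm
      (fun n => Eventually.of_forall fun x => by
        rw [Real.norm_eq_abs, Real.norm_eq_abs, abs_mul]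
        exact mul_le_of_le_one_left (abs_nonneg _) (abs_smoothCutoff_le_one _))
      (Eventually.of_forall fun x => ?_)
    refine (tendsto_const_nhds (x := flipNoise N f x)).congr' ?_
    refine Filter.eventually_atTop.2 ⟨⌈(pinnedChain ω₂ lam β γ).hamiltonian N x⌉₊, fun n hn => ?_⟩
    have h1 := Nat.le_ceil ((pinnedChain ω₂ lam β γ).hamiltonian N x)
    have h2 : (⌈(pinnedChain ω₂ lam β γ).hamiltonian N x⌉₊ : ℝ) ≤ n := by exact_mod_cast hn
    have hlt : (pinnedChain ω₂ lam β γ).hamiltonian N x < (n : ℝ) + 1 := by linarith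
    show flipNoise N f x = smoothCutoff ((pinnedChain ω₂ lam β γ).hamiltonian N x / ((n : ℝ) + 1)) * flipNoise N f x
    rw [(smoothCutoff_div_of_lt (by positivity) hlt).1, one_mul]
  have hlim := tendsto_integral_of_dominated_convergence
    (fun x => K * (Real.exp (ϑ' - ϑ) / (ϑ' - ϑ)) * Real.exp (ϑ' * (pinnedChain ω₂ lam β γ).hamiltonian N x))
    (fun n => (hcont n).aestronglyMeasurable) hbound_int'
    (fun n => Eventually.of_forall fun x => by
      rw [Real.norm_eq_abs]
      exact (key_bd _ x (by simp)).trans (hmaj' x))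
    (Eventually.of_forall fun x => by
      refine tendsto_const_nhds.congr' ?_
      refine Filter.eventually_atTop.2 ⟨⌈(pinnedChain ω₂ lam β γ).hamiltonian N x⌉₊, fun n hn => ?_⟩
      refine (key_far _ x (by positivity) ?_).symm
      have h1 := Nat.le_ceil ((pinnedChain ω₂ lam β γ).hamiltonian N x)
      have h2 : (⌈(pinnedChain ω₂ lam β γ).hamiltonian N x⌉₊ : ℝ) ≤ n := by exact_mod_cast hn
      linarith)
  simp only [hzero] at hlim
  have hlim2 : Tendsto (fun n : ℕ => -ε * ∫ x, smoothCutoff ((pinnedChain ω₂ lam β γ).hamiltonian N x / ((n : ℝ) + 1)) *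
      flipNoise N f x ∂μ) atTop (𝓝 (-ε * ∫ x, flipNoise N f x ∂μ)) := hlimS.const_mul (-ε)
  have hgen : ∫ x, (pinnedChain ω₂ lam β γ).generator N T_L T_R f x ∂μ = -ε * ∫ x, flipNoise N f x ∂μ :=
    tendsto_nhds_unique hlim hlim2
  have hLf_int : Integrable ((pinnedChain ω₂ lam β γ).generator N T_L T_R f) μ := by
    refine (hexp.const_mul C).mono' ((pinnedChain ω₂ lam β γ).continuous_generator hU1 hV1 N T_L T_R
      hf2).aestronglyMeasurable (Eventually.of_forall fun x => ?_)
    rw [Real.norm_eq_abs]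
    exact (hLb x).trans (mul_le_mul_of_nonneg_left (hEE' x) hC0)
  simp only [OscillatorChain.flipGenerator_eq_add_flipNoise]
  rw [integral_add hLf_int (hSf_int.const_mul ε), integral_const_mul, hgen]
  ring


/-! ## Registered helper -/

/-- Registered helper sub-goal `helper_flipWeakEquationExpGrowth` of stub `stub_noisyPositiveConductance` (line
`fekete-usc-one-length`, crux stmt-AtomisticToContinuum-11976): weak flip stationarity extends from `C_c^∞` to smooth
exponentially bounded observables (`pinnedChain_integral_flipGenerator_eq_zero_of_expGrowth`). -/
theorem helper_flipWeakEquationExpGrowth : ∀ (ω₂ lam β γ : ℝ), 0 < ω₂ → 0 ≤ lam → 0 ≤ β → 0 ≤ γ → ∀ (N : ℕ) (hN : 0 < N) (T_L T_R ε : ℝ), 0 ≤ T_L → 0 ≤ T_R → ∀ (μ : MeasureTheory.Measure (Literature.MathematicalPhysics.KineticTheory.HeatConduction.PhaseSpace N)), MeasureTheory.IsFiniteMeasure μ → (∀ g : Literature.MathematicalPhysics.KineticTheory.HeatConduction.PhaseSpace N → ℝ, ContDiff ℝ ((⊤ : ℕ∞) : WithTop ℕ∞) g → HasCompactSupport g →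 MeasureTheory.integral μ (fun x => (Literature.MathematicalPhysics.KineticTheory.HeatConduction.pinnedChain ω₂ lam β γ).flipGenerator N T_L T_R ε g x) = 0) → ∀ (ϑ ϑ' : ℝ), ϑ < ϑ' → MeasureTheory.Integrable (fun x => Real.exp (ϑ' * (Literature.MathematicalPhysics.KineticTheory.HeatConduction.pinnedChain ω₂ lam β γ).hamiltonian N x)) μ → ∀ (f : Literature.MathematicalPhysics.KineticTheory.HeatConduction.PhaseSpace N → ℝ) (C : ℝ), ContDiff ℝ ((⊤ : ℕ∞) : WithTop ℕ∞) f → (∀ x, |f x| ≤ C * Real.exp (ϑ * (Literature.MathematicalPhysics.KineticTheory.HeatConduction.pinnedChain ω₂ lam β γ).hamiltonian N x)) → (∀ x, |(Literature.MathematicalPhysics.KineticTheory.HeatConduction.pinnedChain ω₂ lam β γ).generator N T_L T_R f x| ≤ C * Real.exp (ϑ * (Literature.MathematicalPhysics.KineticTheory.HeatConduction.pinnedChain ω₂ lam β γ).hamiltonian N x)) → (∀ x, |Literature.MathematicalPhysics.KineticTheory.HeatConduction.partialP ⟨0, hN⟩ f x| ≤ C * Real.exp (ϑ * (Literature.MathematicalPhysics.KineticTheory.HeatConduction.pinnedChain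 ω₂ lam β γ).hamiltonian N x)) → (∀ x, |Literature.MathematicalPhysics.KineticTheory.HeatConduction.partialP ⟨N - 1, Nat.sub_lt hN one_pos⟩ f x| ≤ C * Real.exp (ϑ * (Literature.MathematicalPhysics.KineticTheory.HeatConduction.pinnedChain ω₂ lam β γ).hamiltonian N x)) → MeasureTheory.integral μ (fun x => (Literature.MathematicalPhysics.KineticTheory.HeatConduction.pinnedChain ω₂ lam β γ).flipGenerator N T_L T_R ε f x) = 0 :=
  fun _ _ _ _ hω hl hβ hγ _ hN _ _ ε hTL hTR μ hfin hweak _ _ hϑϑ' hexp _ _ hf hfb hLb hP0 hP1 =>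
    haveI := hfin
    pinnedChain_integral_flipGenerator_eq_zero_of_expGrowth hω hl hβ hγ hN hTL hTR ε μ hweak hϑϑ' hexp hf hfb hLb hP0 hP1

end Summit.AtomisticToContinuum.FouriersLaw.Theorems.VanishingNoiseBound

end
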